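/- Copyright: the b2b-balaban cell (near-miss cell 7), T⁴-continuum fan-out, lineage t4-ne7b-p1 (row NE7b OWNER, node U5c
COUNT member), gen 55 — RULING R-OWNER-55-1, companion certificate «THE SURVIVOR».  Released under the licence of the
surrounding project. -/
import Summits.QuantumFields.BalabanUV.T4Continuum.Support.HistoryGenealogyLiveIndex

/-!
# THE SURVIVOR: (ρ0) «NO DEAD INDICES» HOLDS on an admissible input whose single line is RENEWED at every readiness and
lives to every cutoff (re-open object (α) of row NE7b; companion of `HistoryGenealogyLiveIndex`, RULING R-OWNER-55-1 of the
row owner `t4-ne7b-p1` gen 55; built in-seat by the owner)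

Summits-side support leaf of the T⁴-continuum cell (rung (B)+1 on a FINITE torus only; NOT infinite volume, NOT the
mass gap, NOT Clay; NOT a proof of NE7b — the cell's OWN estimate, NOT PRINTED, NOT PROVED).  [folklore] finite
combinatorics over print's process AS DEFINED (`HistoryGenealogyInstantiateM`: `RunInputM`, `StM`, `vertM`, `blocksM`,
`newLineM`, `Fld`; `StM_nonempty_disjoint`) and the owner's `HistoryGenealogyLiveIndex` (`NoHealing`,
`noHealing_iff_died_histV`, `orbit_succ_zero`, the toy letters `LiveIndexToy.z`∕`reg`); nothing printed is asserted, no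
cite-tagged hypothesis, zero `sorry`.

WHY.  `HistoryGenealogyLiveIndex` certifies that (ρ0), typed at the input level as `NoHealing K` («every line READY before
the cutoff carries a NEW FIELD»), has CONTENT: it FAILS on an admissible one-region input with no new-field cubes (the line
dies at its first stop).  The complementary sanity question — the one a pricing desk asks next — is whether (ρ0) can hold
on an admissible input carrying an OLD live line at the cutoff (the configuration NE7b's bad class counts: a live structure
older than `⌊K∕2⌋`), or whether it silently empties the count.  THIS FILE: on the input `toyS` = the toy of
`HistoryGenealogyLiveIndex` with new-field cubes `F j := S^j({origin})` (a new large field inside the line's image at EVERY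
level), the process is, at every level `j`, ONE line with domain `S^j({origin})` (`D_eq_orbit_of_mem_StM`), the line never
dies (`StM_toyS_nonempty`), every line carries a new field (`fld_of_mem_StM`), hence **`noHealing_toyS : ∀ K, NoHealing K`**
and **`died_histV_toyS_empty`** — (ρ0) HOLDS, with a live line descending from the level-`0` region at every cutoff (age
`K`).  So (ρ0) neither follows from nor contradicts the input conditions of record, and is compatible with old live lines:
it is a genuine constraint on the READING, as R-OWNER-55-1 (b) reads print ((1.71)∕(1.72) + (1.98)).

WHAT IS PROVED.  `toyS` and its input conditions (`toyS_newOK`, `toyS_newDisjoint`, `toyS_regionsInBox`, memory rows by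
`le_rfl`); `inl_of_mem_blockS` (with no later regions every vertex is an old line); **`D_eq_orbit_of_mem_StM`** (induction on
the level: the union of the images of a nonempty block all of whose lines have domain `S^j` is `S^{j+1}`);
`fld_of_mem_StM`; `aliveM_of_mem_StM`; **`StM_toyS_nonempty`**; **`noHealing_toyS`**; **`died_histV_toyS_empty`**;
the conjunction **`survivor_content`**.

HONEST SCOPE.  A decided toy on OUR process definition; nothing of Bałaban's is discharged, valued or asserted; BY-NAME
EFFECT ON THE WALL: NONE; census NONE; NE7b NOT proved; spine 0∕9.  HONEST DEPENDENCY (cell): continuum YM on T⁴ ⇐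
BetaPertH ∧ nine spine estimates (0/9 proved); BetaPertH ⇐ (D1) ∧ (D4) ∧ CAP+tail; G-an2-4 gates asym, D1 and NE2/3/4.
This file changes none of it.
-/

open Finset
open Literature.MathematicalPhysics.QuantumFieldTheory.Balaban1983to89
open Literature.MathematicalPhysics.QuantumFieldTheory.Balaban1983to89.B13ScaleTransfer
open Literature.MathematicalPhysics.QuantumFieldTheory.Balaban1983to89.B16SProfile
open Literature.MathematicalPhysics.QuantumFieldTheory.Balaban1983to89.B16MergeGeometry
open Summit.QuantumFields.BalabanUV.T4Continuum.HistoryRealise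
open Summit.QuantumFields.BalabanUV.T4Continuum.HistoryRealiseMemory
open Summit.QuantumFields.BalabanUV.T4Continuum.HistoryRealiseDistinct
open Summit.QuantumFields.BalabanUV.T4Continuum.HistoryGenealogyExtraction
open Summit.QuantumFields.BalabanUV.T4Continuum.HistoryGenealogyRealise
open Summit.QuantumFields.BalabanUV.T4Continuum.HistoryTouchComponents

namespace Summit.QuantumFields.BalabanUV.T4Continuum.HistoryGenealogyInstantiate

noncomputable section

open Classical

namespace LiveIndexToy

/-! ## §1 The survivor input -/

/-- the orbit of the origin cube under the toy flow (`L = 3`, `s ≡ 0`): `O j = S^j({z})` [folklore] -/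
def O (j : ℕ) : Finset (Pt 1) := orbit 3 (fun _ => 0) 0 {z} j

/-- **THE SURVIVOR INPUT**: the toy of `HistoryGenealogyLiveIndex` (one region `reg` at level `0`, `L = 3`, `s ≡ 0`,
`R ≡ Rm ≡ 2`) with NEW-FIELD CUBES `F j := O j` — a new large field inside the line's image at every level. [folklore] -/
def toyS : RunInputM 1 where
  L := 3
  s := fun _ => 0
  R := fun _ => 2
  N := fun j => if j = 0 then {reg} else ∅
  cls := fun _ => 0
  F := O
  Rm := fun _ _ => 2

/-- the survivor's regions are the toy's [folklore] -/
theorem toyS_N_eq : toyS.N = toy.N := rfl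

/-- a region of the survivor is the one region [folklore] -/
theorem eq_reg_of_memS {ℓ : ℕ} {n : Lab 1} (hn : n ∈ toyS.N ℓ) : n = reg := eq_reg_of_mem (toyS_N_eq ▸ hn)

/-- no later regions [folklore] -/
theorem toyS_N_succ (j : ℕ) : toyS.N (j + 1) = ∅ := by simp [toyS]

/-- (G-new) holds [folklore] -/
theorem toyS_newOK : toyS.NewOK := ⟨fun ℓ n hn => toy_newOK.ok ℓ n (toyS_N_eq ▸ hn)⟩

/-- «disjoint new regions» holds [folklore] -/
theorem toyS_newDisjoint : toyS.NewDisjoint := fun _ _ hn _ hn' hne =>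
  absurd ((eq_reg_of_memS hn).trans (eq_reg_of_memS hn').symm) hne

/-- `RegionsInBox` holds on every torus of positive period [folklore] -/
theorem toyS_regionsInBox (nT K : ℕ) (hnT : 0 < nT) : toyS.RegionsInBox nT K := by
  intro j _ nr hnr x hx
  rw [eq_reg_of_memS hnr, show reg.2 = {z} from rfl, Finset.mem_singleton] at hx
  subst hx
  intro i
  refine ⟨le_rfl, ?_⟩
  rw [show (z i).toNat = 0 from rfl, Nat.mul_zero]
  exact Nat.mul_pos hnT (Nat.pow_pos (by decide))

/-! ## §2 The process of the survivor: one line with domain `O j` at every level -/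

/-- with no region at level `j + 1`, every vertex of a block at level `j + 1` is an old line of level `j` [folklore] -/
theorem inl_of_mem_blockS {j : ℕ} {T : Finset (Line 1 ⊕ Lab 1)} (hT : T ∈ toyS.blocksM (j + 1) (toyS.PrevM (j + 1)))
    {x : Line 1 ⊕ Lab 1} (hx : x ∈ T) : ∃ τ ∈ toyS.StM j, x = Sum.inl τ := by
  have hv := subset_of_mem_tcomps hT hx
  cases x with
  | inl τ => exact ⟨τ, (toyS.inl_mem_vertM.1 hv).1, rfl⟩
  | inr n =>
      have h := toyS.inr_mem_vertM.1 hv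
      rw [toyS_N_succ] at h
      simp at h

/-- **EVERY LIVE LINE OF THE SURVIVOR AT LEVEL `j` HAS DOMAIN `O j = S^j({z})`** (induction on the level: a block at level
`j + 1` is a nonempty set of old lines, all with domain `O j`, so the union of its images is `S(O j) = O (j + 1)`).
[folklore] -/
theorem D_eq_orbit_of_mem_StM : ∀ j, ∀ τ ∈ toyS.StM j, τ.D = O j := by
  intro j
  induction j with
  | zero =>
      intro τ hτ
      rw [toyS.StM_zero_singleton (show toyS.N 0 = {reg} by simp [toyS]), Finset.mem_singleton] at hτ
      subst hτ
      rfl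
  | succ j ih =>
      intro τ hτ
      obtain ⟨T, hT, rfl⟩ := toyS.mem_StM_iff.1 hτ
      rw [toyS.newLineM_D, O, orbit_succ_zero, ← O]
      ext y
      rw [mem_fam]
      constructor
      · rintro ⟨x, hx, hy⟩
        obtain ⟨σ, hσ, rfl⟩ := inl_of_mem_blockS hT hx
        have hP : toyS.P (j + 1) (Sum.inl σ) = Sop (ratio 3 (fun _ => 0) j) (O j) := by
          simp [RunInput.P, ih σ hσ, toyS]
        rw [hP] at hy
        exact hy
      · intro hy
        obtain ⟨x, hx⟩ := nonempty_of_mem_tcomps hT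
        obtain ⟨σ, hσ, rfl⟩ := inl_of_mem_blockS hT hx
        refine ⟨Sum.inl σ, hx, ?_⟩
        have hP : toyS.P (j + 1) (Sum.inl σ) = Sop (ratio 3 (fun _ => 0) j) (O j) := by
          simp [RunInput.P, ih σ hσ, toyS]
        rw [hP]
        exact hy

/-- every live line of the survivor carries a new field at its level (its domain IS the level's new-field set and is
nonempty) [folklore] -/
theorem fld_of_mem_StM {j : ℕ} {τ : Line 1} (hτ : τ ∈ toyS.StM j) : toyS.Fld j τ := by
  rw [RunInput.Fld, show toyS.F j = O j from rfl, ← D_eq_orbit_of_mem_StM j τ hτ, Finset.inter_self]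
  exact (toyS.StM_nonempty_disjoint toyS_newOK j).1 τ hτ

/-- hence every live line of the survivor is alive after the 𝐑-operation of its level [folklore] -/
theorem aliveM_of_mem_StM {j : ℕ} {τ : Line 1} (hτ : τ ∈ toyS.StM j) : toyS.AliveM j τ := Or.inr (fld_of_mem_StM hτ)

/-- **THE LINE NEVER DIES**: the survivor has a live line at every level. [folklore] -/
theorem StM_toyS_nonempty : ∀ j, (toyS.StM j).Nonempty := by
  intro j
  induction j with
  | zero =>
      rw [toyS.StM_zero_singleton (show toyS.N 0 = {reg} by simp [toyS])]
      exact Finset.singleton_nonempty _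
  | succ j ih =>
      obtain ⟨τ, hτ⟩ := ih
      have hv : Sum.inl τ ∈ toyS.vertM (j + 1) (toyS.PrevM (j + 1)) :=
        toyS.inl_mem_vertM.2 ⟨hτ, by simpa using aliveM_of_mem_StM hτ⟩
      exact ⟨_, toyS.mem_StM_iff.2 ⟨_, tcomp_mem_tcomps hv, rfl⟩⟩

/-! ## §3 (ρ0) holds on the survivor -/

/-- **(ρ0) HOLDS ON THE SURVIVOR, AT EVERY CUTOFF**: every ready line carries a new field. [folklore] -/
theorem noHealing_toyS (K : ℕ) : toyS.NoHealing K := fun _ _ _ hτ _ => fld_of_mem_StM hτ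

/-- the dissolved bookkeeping of the survivor has no death before any cutoff [folklore] -/
theorem died_histV_toyS_empty (K j : ℕ) (hj : j < K) : toyS.histV.died j = ∅ :=
  (toyS.noHealing_iff_died_histV toyS_newOK (fun _ _ => le_rfl) toyS_newDisjoint (by decide) K).1 (noHealing_toyS K) j hj

/-- **SURVIVOR CERTIFICATE FOR (ρ0)**: on `toyS` EVERY pass-V input condition of the (α) record holds, a live line
descending from the level-`0` region exists at every level (age `j` at level `j`), and (ρ0) HOLDS at every cutoff —
together with `liveIndex_content` (same regions, no new-field cubes: (ρ0) FAILS): «no dead indices» is independent of the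
admissibility of the input and compatible with OLD live lines. [folklore] -/
theorem survivor_content :
    toyS.NewOK ∧ toyS.NewDisjoint ∧ (∀ nT K, 0 < nT → toyS.RegionsInBox nT K) ∧ (∀ t k, toyS.Rm t k ≤ toyS.R t) ∧
      (∀ t k, toyS.Rm t (k + 1) ≤ toyS.R (t + 1)) ∧ (∀ t, 2 ≤ toyS.Rm t 1) ∧ 0 < toyS.L ∧
      (∀ j, (toyS.StM j).Nonempty ∧ ∀ τ ∈ toyS.StM j, τ.D = O j) ∧ (∀ K, toyS.NoHealing K) ∧
      ∀ K j, j < K → toyS.histV.died j = ∅ :=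
  ⟨toyS_newOK, toyS_newDisjoint, toyS_regionsInBox, fun _ _ => le_rfl, fun _ _ => le_rfl, fun _ => le_rfl, by decide,
    fun j => ⟨StM_toyS_nonempty j, D_eq_orbit_of_mem_StM j⟩, noHealing_toyS, died_histV_toyS_empty⟩

end LiveIndexToy

end

end Summit.QuantumFields.BalabanUV.T4Continuum.HistoryGenealogyInstantiate
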